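import Summits.AtomisticToContinuum.FouriersLaw.Theses.PhononMeanFreePath
import Summits.AtomisticToContinuum.FouriersLaw.Theorems.PhononMeanFreePathDefs
import Summits.AtomisticToContinuum.FouriersLaw.Theorems.PhononMeanFreePathCoherentDephasingWeakCouplingIntegrability
import Summits.AtomisticToContinuum.FouriersLaw.Theorems.PhononMeanFreePathCoherentDephasingResponseRegularity
import Summits.AtomisticToContinuum.FouriersLaw.Theorems.PhononMeanFreePathCoherentDephasingMeanFieldDuhamel
import Summits.AtomisticToContinuum.FouriersLaw.Theorems.PhononMeanFreePathCoherentDephasingHarmFluxBound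
import Summits.AtomisticToContinuum.FouriersLaw.Theorems.PhononMeanFreePathCoherentDephasingSiteBookkeeping
import Summits.AtomisticToContinuum.FouriersLaw.Theorems.PhononMeanFreePathCoherentDephasingTelescoping
import Summits.AtomisticToContinuum.FouriersLaw.Theorems.PhononMeanFreePathCoherentDephasingLossComposition
import Summits.AtomisticToContinuum.FouriersLaw.Theorems.PhononMeanFreePathCoherentDephasingOfLocalLossBound

/-!
# `CoherentDephasing` from a BLOCK loss bound (line `Sketch`, crux stmt-AtomisticToContinuum-11810)

The block (coarse-grained) form of the conditional reduction of line `Sketch` (coherent-field Beer–Lambert; skeleton v5,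
`Cruxes/CoherentDephasing/Lines/Sketch.lean`). `…OfLocalLossBound` (p94111) derived the crux from the SITEWISE local loss
bound `κ E_x ≤ s'_x` (`s'_x = siteWork x + γ([x=0]+[x=N])∫₀^∞ m_x²` the total local loss, `E_x = cohEnergy x`); here the
hypothesis is only its BLOCK AVERAGE over `L₀` consecutive sites,

  `∃ L₀ ≥ 1, L, N₀, κ > 0: ∀ N ≥ N₀, ∀ x ≥ L with x + L₀ ≤ N + 1:  κ Σ_{i<L₀} E_{x+i} ≤ Σ_{i<L₀} s'_{x+i}`,

which is implied by the sitewise bound (`L₀ = 1`) and is the natural output of any coarse-graining argument (blocks of a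
few mean free paths). Abstract core `dissipation_le_geometric_blockLoss`: coarse-grain the chain into blocks of `L₀` sites
ending at the far bath; the block-boundary fluxes, block losses and block energies satisfy the hypotheses of the sitewise
lemma `dissipation_le_geometric_loss` (p93671) — block balance by telescoping, block loss bound = the hypothesis, transport
because a boundary bond's two sites lie in the two adjacent blocks — so the far-bath dissipation is at most
`(A/κ)·B·(1+κ)^{-⌊(⌊(N-L)/L₀⌋-1)/2⌋}`. `coherentDephasing_of_blockLossBound` then concludes the crux by name exactly as in
`…OfLocalLossBound` (fixed-`N` layer p90384/p89781/p89923, flux bound p91449, `∫m² ≤ 2E` p93671, `N θ^{(N-c)/L'} → 0` p87005).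
-/

noncomputable section

open MeasureTheory Set Filter Topology

namespace Summit.AtomisticToContinuum.FouriersLaw.Theorems.CoherentDephasing.BlockLoss

open Literature.MathematicalPhysics.KineticTheory.HeatConduction (pinnedChain PhaseSpace)
open Summit.AtomisticToContinuum.FouriersLaw.Theses.PhononMeanFreePath (CoherentDephasing)
open Summit.AtomisticToContinuum.FouriersLaw.Theorems.PhononMeanFreePath
open Summit.AtomisticToContinuum.FouriersLaw.Theorems.CoherentDephasing.Telescoping (tendsto_natMul_pow_div)
open Summit.AtomisticToContinuum.FouriersLaw.Theorems.CoherentDephasing.MeanFieldDuhamel (stub_meanFieldDuhamel)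
open Summit.AtomisticToContinuum.FouriersLaw.Theorems.CoherentDephasing.ResponseRegularity (stub_responseRegularity)
open Summit.AtomisticToContinuum.FouriersLaw.Theorems.CoherentDephasing.SiteBookkeeping (stub_siteBookkeeping_of_meanField)
open Summit.AtomisticToContinuum.FouriersLaw.Theorems.CoherentDephasing.HarmFluxBound (stub_harmFluxBound)
open Summit.AtomisticToContinuum.FouriersLaw.Theorems.CoherentDephasing.LossComposition
  (dissipation_le_geometric_loss integral_momResp_sq_le_two_cohEnergy)
open Summit.AtomisticToContinuum.FouriersLaw.Theorems.CoherentDephasing.OfLocalLossBound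
  (sum_ite_succ_eq sum_ite_val_eq_of_lt sum_ite_val_eq_zero)

/-! ## Abstract part: coarse-graining to the sitewise lemma -/

/-- **Geometric decay of the coherent flux from a BLOCK loss bound** (abstract core of skeleton v5 of line `Sketch`).
`J, s, E : ℕ → ℝ` as in `dissipation_le_geometric_loss` (`J N = 0`, every flux `≤ B`, site balances `J (x-1) - J x = s x`
beyond the head, `E ≥ 0`, transport `J b ≤ E b + E (b+1)`), but the loss bound is assumed only for sums over blocks of
`L₀ ≥ 1` consecutive sites beyond the head: `κ Σ_{i<L₀} E (x+i) ≤ Σ_{i<L₀} s (x+i)`. Coarse-graining into the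
`K = ⌊(N-L)/L₀⌋` blocks of `L₀` sites ending at `N` reduces to the sitewise lemma, whence
`D ≤ (A/κ)·B·(1+κ)^{-⌊(K-1)/2⌋}` for any `D ≤ A·E N`, `A ≥ 0`. [folklore] -/
theorem dissipation_le_geometric_blockLoss :
    ∀ (J s E : ℕ → ℝ) (D A B κ : ℝ) (N L L₀ : ℕ), 0 < κ → 0 ≤ A → 0 < L₀ → L + L₀ ≤ N → J N = 0 → (∀ b, b < N → J b ≤ B) → (∀ x, L < x → x ≤ N → J (x - 1) - J x = s x) → (∀ x, L < x → x + L₀ ≤ N + 1 → κ * ∑ i ∈ Finset.range L₀, E (x + i) ≤ ∑ i ∈ Finset.range L₀, s (x + i)) → (∀ x, 0 ≤ E x) → (∀ b, b + 1 ≤ N → J b ≤ E b + E (b + 1)) → D ≤ A * E N → D ≤ A / κ * B * (1 / (1 + κ)) ^ (((N - L) / L₀ - 1) / 2) := by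
  intro J s E D A B κ N L L₀ hκ hA hL₀ hN hJN hhead hbal hloss hE htr hD
  -- number of blocks `K ≥ 1` and the origin `x₀ = N - K L₀ ≥ L` of the block lattice
  set K : ℕ := (N - L) / L₀ with hK
  have hKL : K * L₀ ≤ N - L := Nat.div_mul_le_self _ _
  have hK1 : 1 ≤ K := (Nat.le_div_iff_mul_le hL₀).2 (by rw [one_mul]; omega)
  have hKL₀ : L₀ ≤ K * L₀ := Nat.le_mul_of_pos_left L₀ hK1
  set x₀ : ℕ := N - K * L₀ with hx₀
  have hx₀L : L ≤ x₀ := by omega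
  have hx₀N : x₀ + K * L₀ = N := by omega
  -- products `j * L₀`: the facts `omega` needs, stated on the atoms it sees
  have hmulS : ∀ j : ℕ, (j + 1) * L₀ = j * L₀ + L₀ := fun j => Nat.succ_mul j L₀
  have hmulK : ∀ j : ℕ, j ≤ K → j * L₀ ≤ K * L₀ := fun j hj => Nat.mul_le_mul_right L₀ hj
  have hmul1 : ∀ j : ℕ, 1 ≤ j → L₀ ≤ j * L₀ := fun j hj => Nat.le_mul_of_pos_left L₀ hj
  -- coarse families: boundary fluxes, block energies (block `j ≥ 1` = sites `x₀+(j-1)L₀+1 … x₀+jL₀`; `Et 0 = E x₀`),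
  -- block losses defined as flux drops
  set Jt : ℕ → ℝ := fun j => J (x₀ + j * L₀) with hJt
  set Et : ℕ → ℝ := fun j =>
    if j = 0 then E x₀ else ∑ i ∈ Finset.range L₀, E (x₀ + j * L₀ - L₀ + 1 + i) with hEt
  set st : ℕ → ℝ := fun j => Jt (j - 1) - Jt j with hst
  -- block balance by telescoping: `Jt (j-1) - Jt j = Σ_{i<L₀} s (x₀ + jL₀ - L₀ + 1 + i)` for `1 ≤ j ≤ K`
  have hblock : ∀ j, 1 ≤ j → j ≤ K →
      Jt (j - 1) - Jt j = ∑ i ∈ Finset.range L₀, s (x₀ + j * L₀ - L₀ + 1 + i) := by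
    intro j hj1 hjK
    have hjL := hmul1 j hj1
    have hjK' := hmulK j hjK
    have hc : x₀ + (j - 1) * L₀ = x₀ + j * L₀ - L₀ := by rw [Nat.sub_one_mul]; omega
    have htel : ∑ i ∈ Finset.range L₀, s (x₀ + j * L₀ - L₀ + 1 + i) =
        ∑ i ∈ Finset.range L₀, (J (x₀ + j * L₀ - L₀ + i) - J (x₀ + j * L₀ - L₀ + (i + 1))) := by
      refine Finset.sum_congr rfl fun i hi => ?_
      rw [Finset.mem_range] at hi
      have h := hbal (x₀ + j * L₀ - L₀ + 1 + i) (by omega) (by omega)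
      rw [show x₀ + j * L₀ - L₀ + 1 + i - 1 = x₀ + j * L₀ - L₀ + i by omega] at h
      rw [← h, show x₀ + j * L₀ - L₀ + (i + 1) = x₀ + j * L₀ - L₀ + 1 + i by omega]
    rw [htel, Finset.sum_range_sub' (fun i => J (x₀ + j * L₀ - L₀ + i)) L₀]
    simp only [hJt, add_zero]
    rw [hc, show x₀ + j * L₀ - L₀ + L₀ = x₀ + j * L₀ by omega]
  -- apply the sitewise lemma to the coarse families (head index `0`, `K` blocks)
  have key := dissipation_le_geometric_loss Jt st Et D A B κ K 0 hκ hA (by omega) ?_ ?_ ?_ ?_ ?_ ?_ ?_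
  · simpa only [Nat.sub_zero] using key
  · -- `Jt K = 0`
    simp only [hJt, hx₀N, hJN]
  · -- head: `Jt 0 = J x₀ ≤ B`
    simp only [hJt, zero_mul, add_zero]
    exact hhead x₀ (by omega)
  · -- balances (by definition of `st`)
    intro j _ _; simp only [hst]
  · -- block loss bound
    intro j hj1 hjK
    have hjL := hmul1 j hj1
    have hjK' := hmulK j hjK
    simp only [hst, hEt, if_neg (show j ≠ 0 by omega)]
    rw [hblock j hj1 hjK]
    have h := hloss (x₀ + j * L₀ - L₀ + 1) (by omega) (by omega)
    simpa only [add_assoc] using h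
  · -- `Et ≥ 0`
    intro j; simp only [hEt]; split_ifs
    · exact hE _
    · exact Finset.sum_nonneg fun i _ => hE _
  · -- transport across a block boundary
    intro j hjK
    have hjK' := hmulK (j + 1) hjK
    rw [hmulS] at hjK'
    have h1 : Jt j ≤ E (x₀ + j * L₀) + E (x₀ + j * L₀ + 1) := by
      simp only [hJt]; exact htr _ (by omega)
    have h2 : E (x₀ + j * L₀) ≤ Et j := by
      simp only [hEt]
      split_ifs with hj0
      · rw [hj0, zero_mul, add_zero]
      · have hjL := hmul1 j (by omega)
        have hmem : L₀ - 1 ∈ Finset.range L₀ := Finset.mem_range.2 (by omega)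
        have := Finset.single_le_sum (f := fun i => E (x₀ + j * L₀ - L₀ + 1 + i)) (fun i _ => hE _) hmem
        rwa [show x₀ + j * L₀ - L₀ + 1 + (L₀ - 1) = x₀ + j * L₀ by omega] at this
    have h3 : E (x₀ + j * L₀ + 1) ≤ Et (j + 1) := by
      have hEq : Et (j + 1) = ∑ i ∈ Finset.range L₀, E (x₀ + j * L₀ + 1 + i) := by
        simp only [hEt, if_neg (Nat.succ_ne_zero j)]
        refine Finset.sum_congr rfl fun i _ => ?_
        have := hmulS j
        congr 1; omega
      rw [hEq]
      have hmem : 0 ∈ Finset.range L₀ := Finset.mem_range.2 hL₀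
      have := Finset.single_le_sum (f := fun i => E (x₀ + j * L₀ + 1 + i)) (fun i _ => hE _) hmem
      simpa using this
    linarith
  · -- `D ≤ A · Et K` (site `N` is the last site of the last block)
    have h2 : E N ≤ Et K := by
      simp only [hEt, if_neg (show K ≠ 0 by omega)]
      have hmem : L₀ - 1 ∈ Finset.range L₀ := Finset.mem_range.2 (by omega)
      have := Finset.single_le_sum (f := fun i => E (x₀ + K * L₀ - L₀ + 1 + i)) (fun i _ => hE _) hmem
      rwa [show x₀ + K * L₀ - L₀ + 1 + (L₀ - 1) = N by omega] at this
    exact hD.trans (mul_le_mul_of_nonneg_left h2 hA)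


/-! ## The conditional reduction (block form) -/

/-- **`CoherentDephasing` from the block loss bound.** If for every admissible parameter point there are a block length
`L₀ ≥ 1`, a head margin `L`, a threshold `N₀` and a rate `κ > 0` such that for every chain with `N ≥ N₀` and every block of
`L₀` consecutive sites `x, …, x+L₀-1` beyond the head (`x ≥ L`, `x + L₀ ≤ N + 1`) the total local loss summed over the
block is at least `κ ×` the time-integrated coherent energy summed over the block, then the coherent channel closes
(`CoherentDephasing`, by name). The sitewise bound of `…OfLocalLossBound` is the case `L₀ = 1`. [folklore] -/
theorem coherentDephasing_of_blockLossBound :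
    (∀ ω₂ lam β γ : ℝ, 0 < ω₂ → 0 < lam → 0 < β → 0 < γ → ∀ T : ℝ, 0 < T → ∃ L₀ L N₀ : ℕ, ∃ κ : ℝ, 0 < L₀ ∧ 0 < κ ∧ ∀ N : ℕ, N₀ ≤ N → ∀ (x : ℕ) (hx : x + L₀ ≤ N + 1), L ≤ x → κ * ∑ i : Fin L₀, cohEnergy ω₂ lam β γ T N ⟨x + i, by omega⟩ ≤ ∑ i : Fin L₀, (siteWork ω₂ lam β γ T N ⟨x + i, by omega⟩ + γ * ((if x + (i : ℕ) = 0 then 1 else 0) + (if x + (i : ℕ) = N then 1 else 0)) * ∫ t in Set.Ioi (0 : ℝ), momResp ω₂ lam β γ T N ⟨x + i, by omega⟩ t ^ 2)) → Summit.AtomisticToContinuum.FouriersLaw.Theses.PhononMeanFreePath.CoherentDephasing := by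
  intro hLoss ω₂ lam β γ hω hl hβ hγ T hT
  refine ⟨fun N => Summit.AtomisticToContinuum.FouriersLaw.Theorems.CoherentDephasing.pairCorr_sq_integrableOn
    hω hl.le hβ hγ hT N, ?_⟩
  obtain ⟨B, hBflux⟩ := stub_harmFluxBound ω₂ lam β γ hω hl hβ hγ T hT
  obtain ⟨L₀, L, N₀, κ, hL₀, hκ, hloss⟩ := hLoss ω₂ lam β γ hω hl hβ hγ T hT
  have hbook := fun N => stub_siteBookkeeping_of_meanField ω₂ lam β γ hω hl hβ hγ T hT N
    (stub_meanFieldDuhamel ω₂ lam β γ hω hl hβ hγ T hT N) (stub_responseRegularity ω₂ lam β γ hω hl hβ hγ T hT N)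
  have h2E := integral_momResp_sq_le_two_cohEnergy ω₂ lam β γ hω hl hβ hγ T hT
  set D : ℕ → ℝ := fun N => γ * ∫ t in Ioi (0 : ℝ), momResp ω₂ lam β γ T N (Fin.last N) t ^ 2 with hD
  set θ : ℝ := 1 / (1 + κ) with hθ
  have hθ0 : 0 ≤ θ := by positivity
  have hθ1 : θ < 1 := by rw [hθ, div_lt_one (by positivity)]; linarith
  have hI0 : ∀ N : ℕ, 0 ≤ ∫ t in Ioi (0 : ℝ), momResp ω₂ lam β γ T N (Fin.last N) t ^ 2 := fun N =>
    setIntegral_nonneg measurableSet_Ioi fun t _ => sq_nonneg _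
  have hgeo : ∀ N : ℕ, N₀ ≤ N → L + L₀ ≤ N → D N ≤ 2 * γ / κ * B * θ ^ (((N - L) / L₀ - 1) / 2) := by
    intro N hN0 hN
    obtain ⟨hbal, htr⟩ := hbook N
    -- `ℕ`-indexed flux `J`, total local loss `S = s_x + [x = N] D_N` (for `x ≥ 1`) and site energy `E`, junk `0` out of range
    refine dissipation_le_geometric_blockLoss
      (fun b => if h : b < N then harmFlux ω₂ lam β γ T N ⟨b, h⟩ else 0)
      (fun x => (if h : x < N + 1 then siteWork ω₂ lam β γ T N ⟨x, h⟩ else 0) + (if x = N then D N else 0))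
      (fun x => if h : x < N + 1 then cohEnergy ω₂ lam β γ T N ⟨x, h⟩ else 0)
      (D N) (2 * γ) B κ N L L₀ hκ (by positivity) hL₀ hN ?_ ?_ ?_ ?_ ?_ ?_ ?_
    · -- `J N = 0`
      rw [dif_neg (lt_irrefl N)]
    · -- every flux `≤ B`
      intro b hb; rw [dif_pos hb]; exact hBflux N ⟨b, hb⟩
    · -- site balances beyond the head, read off the bookkeeping stub
      intro x hx1 hx2
      have h := hbal ⟨x, by omega⟩
      rw [sum_ite_succ_eq N _ (show ((⟨x, by omega⟩ : Fin (N + 1)) : ℕ) - 1 < N by simp only; omega)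
        (show ((⟨x, by omega⟩ : Fin (N + 1)) : ℕ) ≠ 0 by simp only; omega)] at h
      simp only at h
      rw [if_neg (by omega), if_neg (by omega)] at h
      rw [dif_pos (show x - 1 < N by omega), dif_pos (show x < N + 1 by omega)]
      by_cases hxN : x = N
      · have hfin : ∀ h : x < N + 1, (⟨x, h⟩ : Fin (N + 1)) = Fin.last N := fun _ => Fin.ext hxN
        rw [sum_ite_val_eq_zero N _ (show ¬ ((⟨x, _⟩ : Fin (N + 1)) : ℕ) < N by simp only; omega),
          if_pos hxN] at h
        rw [dif_neg (show ¬ x < N by omega), if_pos hxN]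
        simp only [hfin] at h ⊢
        simp only [hD]
        linarith
      · rw [sum_ite_val_eq_of_lt N _ (show ((⟨x, _⟩ : Fin (N + 1)) : ℕ) < N by simp only; omega),
          if_neg hxN] at h
        rw [dif_pos (show x < N by omega), if_neg hxN]
        simp only [add_zero, mul_zero] at h
        linarith
    · -- the block loss bound (the hypothesis), moved from `Fin L₀`-sums over the route objects to `range`-sums
      intro x hx1 hx2
      have h := hloss N hN0 x hx2 (le_of_lt hx1)
      have e1 : ∑ i : Fin L₀, cohEnergy ω₂ lam β γ T N ⟨x + i, by omega⟩ =
          ∑ i : Fin L₀, (fun y => if h : y < N + 1 then cohEnergy ω₂ lam β γ T N ⟨y, h⟩ else 0) (x + i) := by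
        refine Finset.sum_congr rfl fun i _ => ?_
        simp only
        rw [dif_pos (show x + (i : ℕ) < N + 1 by omega)]
      have e2 : ∑ i : Fin L₀, (siteWork ω₂ lam β γ T N ⟨x + i, by omega⟩ +
            γ * ((if x + (i : ℕ) = 0 then 1 else 0) + (if x + (i : ℕ) = N then 1 else 0)) *
              ∫ t in Set.Ioi (0 : ℝ), momResp ω₂ lam β γ T N ⟨x + i, by omega⟩ t ^ 2) =
          ∑ i : Fin L₀, (fun y => (if h : y < N + 1 then siteWork ω₂ lam β γ T N ⟨y, h⟩ else 0) +
            (if y = N then D N else 0)) (x + i) := by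
        refine Finset.sum_congr rfl fun i _ => ?_
        simp only
        rw [dif_pos (show x + (i : ℕ) < N + 1 by omega), if_neg (show x + (i : ℕ) ≠ 0 by omega)]
        by_cases hxN : x + (i : ℕ) = N
        · have hfin : ∀ h : x + (i : ℕ) < N + 1, (⟨x + i, h⟩ : Fin (N + 1)) = Fin.last N :=
            fun _ => Fin.ext hxN
          rw [if_pos hxN, if_pos hxN, hfin]
          simp only [hD]
          ring
        · rw [if_neg hxN, if_neg hxN]
          ring
      rw [e1, e2] at h
      rw [Finset.sum_range, Finset.sum_range]
      exact h
    · -- `E ≥ 0`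
      intro x
      split_ifs
      · exact cohEnergy_nonneg ω₂ lam β γ T N hω.le _
      · exact le_rfl
    · -- transport
      intro b hb
      rw [dif_pos (show b < N by omega), dif_pos (show b < N + 1 by omega), dif_pos (show b + 1 < N + 1 by omega)]
      exact htr ⟨b, by omega⟩
    · -- `D N ≤ 2γ E_N`
      rw [dif_pos (Nat.lt_succ_self N)]
      have hlast : (⟨N, Nat.lt_succ_self N⟩ : Fin (N + 1)) = Fin.last N := rfl
      rw [hlast]
      simp only [hD]
      have := h2E N (Fin.last N)
      nlinarith [hγ]
  -- the exponent `((N - L)/L₀ - 1)/2 = (N - (L + L₀))/(L₀ · 2)` for `L + L₀ ≤ N`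
  have hexp : ∀ N : ℕ, L + L₀ ≤ N → ((N - L) / L₀ - 1) / 2 = (N - (L + L₀)) / (L₀ * 2) := by
    intro N hN
    rw [← Nat.sub_mul_div (N - L) L₀ 1, Nat.div_div_eq_div_mul]
    congr 1
    omega
  -- squeeze `0 ≤ N ∫ m_N² ≤ (N/γ)(2γ/κ) B θ^{…} → 0`
  have hlim := (tendsto_natMul_pow_div θ hθ0 hθ1 (L₀ * 2) (by positivity) (L + L₀)).const_mul (2 * γ / κ * B / γ)
  rw [mul_zero] at hlim
  change Tendsto (fun N : ℕ => (N : ℝ) * ∫ t in Ioi (0 : ℝ), momResp ω₂ lam β γ T N (Fin.last N) t ^ 2) atTop (𝓝 0)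
  refine squeeze_zero' (Eventually.of_forall fun N => mul_nonneg (Nat.cast_nonneg N) (hI0 N)) ?_ hlim
  filter_upwards [eventually_ge_atTop (max N₀ (L + L₀))] with N hN
  have hN0 : N₀ ≤ N := le_of_max_le_left hN
  have hN1 : L + L₀ ≤ N := le_of_max_le_right hN
  have h1 : (N : ℝ) * ∫ t in Ioi (0 : ℝ), momResp ω₂ lam β γ T N (Fin.last N) t ^ 2 = (N : ℝ) * (D N / γ) := by
    simp only [hD]; field_simp
  rw [h1]
  have h2 : D N / γ ≤ 2 * γ / κ * B / γ * θ ^ ((N - (L + L₀)) / (L₀ * 2)) := by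
    have := div_le_div_of_nonneg_right (hgeo N hN0 hN1) hγ.le
    rw [hexp N hN1] at this
    calc D N / γ ≤ 2 * γ / κ * B * θ ^ ((N - (L + L₀)) / (L₀ * 2)) / γ := this
      _ = 2 * γ / κ * B / γ * θ ^ ((N - (L + L₀)) / (L₀ * 2)) := by ring
  calc (N : ℝ) * (D N / γ) ≤ (N : ℝ) * (2 * γ / κ * B / γ * θ ^ ((N - (L + L₀)) / (L₀ * 2))) :=
      mul_le_mul_of_nonneg_left h2 (Nat.cast_nonneg N)
    _ = 2 * γ / κ * B / γ * ((N : ℝ) * θ ^ ((N - (L + L₀)) / (L₀ * 2))) := by ring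

end Summit.AtomisticToContinuum.FouriersLaw.Theorems.CoherentDephasing.BlockLoss

end
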